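import Mathlib
import Literature.Analysis.FluidPDE.VectorCalculus
import Literature.Analysis.FluidPDE.VorticityStretching
import Summits.NavierStokesRegularity.NavierStokesRegularity.Theorems.ThreadingFluxCentreJetDefs
import Summits.NavierStokesRegularity.NavierStokesRegularity.Theorems.ThreadingFluxPlatonicDefs
import Summits.NavierStokesRegularity.NavierStokesRegularity.Theorems.ThreadingFluxPlatonicSymmetryAlgebra
import HarnessLib

/-!
# Crux `PoloidalLiouville` (stmt-NavierStokesRegularity-1222, wall W1), crux idea «platonic-germ-sieve» (ns-idea-15 g11, V27
# PASS-WITH-PRICE): SCHUR AT THE CENTRE — the finite-dimensional algebra of the low jets of an O-equivariant field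

Support file (Theorems-side; seat ns-wall-eng-7 g9, cell `ns-wall-extremal`, W1 adjunct; director-ns g19 p109 GO; critic ns-wall-crit-1
g7 BATCH #24 NO STRIKE; `--supports stmt-NavierStokesRegularity-1222 --as helper`; 0 kit).  Pure linear algebra over the Defs twin
`ThreadingFluxPlatonicDefs` (p721671: `cubeRot`, `IsCubeRotationData`) and ns-wall-eng-8 g6's `ThreadingFluxPlatonicSymmetryAlgebra`
(p722437: the coordinate half-turns and the 3-cycle as rotations of the cube, `cubeRot_cycle_apply`), imported BY NAME:

* the QUARTER-TURN about `e₂`, `q : (x₀, x₁, x₂) ↦ (−x₁, x₀, x₂)` = `cubeRot (swap 0 1) ![-1, 1, 1]`, is a rotation of the cube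
  (`isCubeRotationData_quarterTurn`) — the fifth generator used below, the one that separates O from the tetrahedral group T;
* `CentreFlat.clm_eq_smul_id` — **Schur for O by hand**: a linear map of `ℝ³` commuting with the half-turns about `e₀`, `e₁` and the
  coordinate 3-cycle is a multiple of the identity (half-turn parities kill the off-diagonal entries, the 3-cycle equalises the
  diagonal);
* `CentreFlat.bilin_eq_zero` — **there is no quadratic O-equivariant**: a SYMMETRIC bilinear map `ℝ³ × ℝ³ → ℝ³` commuting with the
  half-turns about `e₀`, `e₁`, the 3-cycle and the quarter-turn `q` is zero (the 21 entries with a repeated index die by parity, the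
  3-cycle equalises the six entries with distinct indices to one constant `c`, i.e. the candidate is `c · (x₁x₂, x₂x₀, x₀x₁) = c∇(x₀x₁x₂)`,
  and `q` reverses its sign).  «O, NOT T»: the tetrahedral rotation group keeps the quadratic equivariant jet `∇(x₀x₁x₂)`, so the
  quarter-turn is load-bearing; SYMMETRY is load-bearing too — the skew map `u × v` is even `SO(3)`-equivariant;
* `CentreFlat.curlCLM_halfTurn` / `curlCLM_cycle` / `curlCLM_quarterTurn` — the curl of a Jacobian is a PSEUDO-VECTOR under these
  rotations: `D' ∘ g = g ∘ D ⇒ curlCLM D' = g (curlCLM D)` (explicit coordinates through the tree's `curlCLM_apply`).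

Consumed by `Theorems/ThreadingFluxPlatonicCentreJetFlat.lean` (the jets (J0)–(J3) of an O-equivariant germ at its centre).  By Solomon's
theorem (L. Solomon, Invariants of finite reflection groups, Nagoya Math. J. 22 (1963) 57–64) the O_h-equivariant polynomial maps form a
free module over the invariants on the gradients of the basic invariants (degrees 2, 4, 6) — the conceptual reason behind (J1)–(J3); the
kernel proofs here are by hand.  HONEST LABEL: representation-theoretic tools strictly below W1; no statement of the card is asserted;
`OctahedralCentreRigidity`, `PoloidalLiouville` (1222), `UnthreadedRigidity` (27585) and NS regularity are OPEN — NOT proved.  [folklore]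
-/

-- the summit and its single sub-problem share the name (CONVENTIONS §1)
set_option linter.dupNamespace false

noncomputable section

open Set Function Filter Metric
open scoped RealInnerProductSpace Topology
open Literature.Analysis.FluidPDE
open Summit.NavierStokesRegularity.NavierStokesRegularity.Theorems.PoloidalLiouville.CentreJet (E3)

namespace Summit.NavierStokesRegularity.NavierStokesRegularity.Theorems.PoloidalLiouville.Platonic

namespace CentreFlat

/-! ### The five generators in coordinates: half-turns `diag(s)`, the 3-cycle `c`, the quarter-turn `q` -/

/-- Coordinates of a coordinate sign change `cubeRot 1 s` (`σ = 1`): `(h x)ᵢ = sᵢ xᵢ`. -/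
theorem cubeRot_one_apply (s : Fin 3 → ℝ) (x : E3) (i : Fin 3) : cubeRot 1 s x i = s i * x i := by
  simp [cubeRot]

/-- A coordinate sign change rescales the standard basis vectors: `h eⱼ = sⱼ eⱼ`. -/
theorem cubeRot_one_single (s : Fin 3 → ℝ) (j : Fin 3) :
    cubeRot 1 s (EuclideanSpace.single j (1 : ℝ)) = s j • EuclideanSpace.single j (1 : ℝ) := by
  ext i
  rw [cubeRot_one_apply, PiLp.smul_apply, smul_eq_mul]
  by_cases h : i = j
  · subst h; simp
  · simp [h]

/-- The coordinate 3-cycle `c : (x₀,x₁,x₂) ↦ (x₁,x₂,x₀)` sends `e₁ ↦ e₀`. -/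
theorem cubeRot_cycle_single_one :
    cubeRot (finRotate 3) (fun _ => 1) (EuclideanSpace.single 1 (1 : ℝ)) = EuclideanSpace.single 0 (1 : ℝ) := by
  rw [cubeRot_cycle_apply]; ext i; fin_cases i <;> simp

/-- The coordinate 3-cycle sends `e₂ ↦ e₁`. -/
theorem cubeRot_cycle_single_two :
    cubeRot (finRotate 3) (fun _ => 1) (EuclideanSpace.single 2 (1 : ℝ)) = EuclideanSpace.single 1 (1 : ℝ) := by
  rw [cubeRot_cycle_apply]; ext i; fin_cases i <;> simp

/-- The coordinate 3-cycle sends `e₀ ↦ e₂`. -/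
theorem cubeRot_cycle_single_zero :
    cubeRot (finRotate 3) (fun _ => 1) (EuclideanSpace.single 0 (1 : ℝ)) = EuclideanSpace.single 2 (1 : ℝ) := by
  rw [cubeRot_cycle_apply]; ext i; fin_cases i <;> simp

/-- Coordinate `0` of the 3-cycle: `(c x)₀ = x₁`. -/
theorem cubeRot_cycle_apply_zero (x : E3) : cubeRot (finRotate 3) (fun _ => 1) x 0 = x 1 := by
  rw [cubeRot_cycle_apply]; simp

/-- Coordinate `1` of the 3-cycle: `(c x)₁ = x₂`. -/
theorem cubeRot_cycle_apply_one (x : E3) : cubeRot (finRotate 3) (fun _ => 1) x 1 = x 2 := by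
  rw [cubeRot_cycle_apply]; simp

/-- Coordinate `2` of the 3-cycle: `(c x)₂ = x₀`. -/
theorem cubeRot_cycle_apply_two (x : E3) : cubeRot (finRotate 3) (fun _ => 1) x 2 = x 0 := by
  rw [cubeRot_cycle_apply]; simp

/-- Coordinates of the quarter-turn `q` about `e₂`: `q (x₀, x₁, x₂) = (−x₁, x₀, x₂)`. -/
theorem cubeRot_quarterTurn_apply (x : E3) :
    cubeRot (Equiv.swap 0 1) ![-1, 1, 1] x = WithLp.toLp 2 ![-x 1, x 0, x 2] := by
  ext i
  fin_cases i <;> simp [cubeRot, Equiv.swap_apply_of_ne_of_ne]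

/-- The quarter-turn about `e₂`, `(x₀, x₁, x₂) ↦ (−x₁, x₀, x₂)` (`σ = swap 0 1`, `s = (−1, 1, 1)`), is a rotation of the cube. -/
theorem isCubeRotationData_quarterTurn : IsCubeRotationData (Equiv.swap 0 1) ![-1, 1, 1] :=
  ⟨by intro i; fin_cases i <;> simp, by simp [Fin.prod_univ_three]⟩

/-- Coordinate `1` of the quarter-turn: `(q x)₁ = x₀`. -/
theorem cubeRot_quarterTurn_apply_one (x : E3) : cubeRot (Equiv.swap 0 1) ![-1, 1, 1] x 1 = x 0 := by
  rw [cubeRot_quarterTurn_apply]; simp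

/-- The quarter-turn sends `e₁ ↦ −e₀`. -/
theorem cubeRot_quarterTurn_single_one :
    cubeRot (Equiv.swap 0 1) ![-1, 1, 1] (EuclideanSpace.single 1 (1 : ℝ)) = -EuclideanSpace.single 0 (1 : ℝ) := by
  rw [cubeRot_quarterTurn_apply]; ext i; fin_cases i <;> simp

/-- The quarter-turn fixes `e₂`. -/
theorem cubeRot_quarterTurn_single_two :
    cubeRot (Equiv.swap 0 1) ![-1, 1, 1] (EuclideanSpace.single 2 (1 : ℝ)) = EuclideanSpace.single 2 (1 : ℝ) := by
  rw [cubeRot_quarterTurn_apply]; ext i; fin_cases i <;> simp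

/-! ### Schur for O: linear and symmetric bilinear equivariants -/

/-- Parities of a linear map commuting with a coordinate half-turn. -/
theorem parity_one {D : E3 →L[ℝ] E3} {s : Fin 3 → ℝ}
    (hs : ∀ v, D (cubeRot 1 s v) = cubeRot 1 s (D v)) (j i : Fin 3) :
    s j * D (EuclideanSpace.single j (1 : ℝ)) i = s i * D (EuclideanSpace.single j (1 : ℝ)) i := by
  have h := congrArg (fun w : E3 => w i) (hs (EuclideanSpace.single j 1))
  simp only [cubeRot_one_single, map_smul, PiLp.smul_apply, smul_eq_mul, cubeRot_one_apply] at h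
  exact h

/-- **Schur for O, by hand.**  A linear map of `ℝ³` commuting with the half-turns about `e₀`, `e₁` and with the coordinate
3-cycle is a multiple of the identity. -/
theorem clm_eq_smul_id (D : E3 →L[ℝ] E3)
    (h0 : ∀ v, D (cubeRot 1 ![1, -1, -1] v) = cubeRot 1 ![1, -1, -1] (D v))
    (h1 : ∀ v, D (cubeRot 1 ![-1, 1, -1] v) = cubeRot 1 ![-1, 1, -1] (D v))
    (hc : ∀ v, D (cubeRot (finRotate 3) (fun _ => 1) v) = cubeRot (finRotate 3) (fun _ => 1) (D v)) :
    D = (D (EuclideanSpace.single 0 (1 : ℝ)) 0) • ContinuousLinearMap.id ℝ E3 := by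
  -- off-diagonal entries vanish (half-turn parities)
  have o01 : D (EuclideanSpace.single 0 (1 : ℝ)) 1 = 0 := by
    have := parity_one h0 0 1; norm_num [Matrix.cons_val_two, Matrix.tail_cons, Matrix.head_cons] at this; linarith
  have o02 : D (EuclideanSpace.single 0 (1 : ℝ)) 2 = 0 := by
    have := parity_one h0 0 2; norm_num [Matrix.cons_val_two, Matrix.tail_cons, Matrix.head_cons] at this; linarith
  have o10 : D (EuclideanSpace.single 1 (1 : ℝ)) 0 = 0 := by
    have := parity_one h0 1 0; norm_num [Matrix.cons_val_two, Matrix.tail_cons, Matrix.head_cons] at this; linarith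
  have o20 : D (EuclideanSpace.single 2 (1 : ℝ)) 0 = 0 := by
    have := parity_one h0 2 0; norm_num [Matrix.cons_val_two, Matrix.tail_cons, Matrix.head_cons] at this; linarith
  have o12 : D (EuclideanSpace.single 1 (1 : ℝ)) 2 = 0 := by
    have := parity_one h1 1 2; norm_num [Matrix.cons_val_two, Matrix.tail_cons, Matrix.head_cons] at this; linarith
  have o21 : D (EuclideanSpace.single 2 (1 : ℝ)) 1 = 0 := by
    have := parity_one h1 2 1; norm_num [Matrix.cons_val_two, Matrix.tail_cons, Matrix.head_cons] at this; linarith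
  -- diagonal entries agree (3-cycle)
  have d00 : D (EuclideanSpace.single 0 (1 : ℝ)) 0 = D (EuclideanSpace.single 1 (1 : ℝ)) 1 := by
    have h := congrArg (fun w : E3 => w 0) (hc (EuclideanSpace.single 1 1))
    simp only [cubeRot_cycle_single_one, cubeRot_cycle_apply_zero] at h
    exact h
  have d11 : D (EuclideanSpace.single 1 (1 : ℝ)) 1 = D (EuclideanSpace.single 2 (1 : ℝ)) 2 := by
    have h := congrArg (fun w : E3 => w 1) (hc (EuclideanSpace.single 2 1))
    simp only [cubeRot_cycle_single_two, cubeRot_cycle_apply_one] at h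
    exact h
  ext v i
  have hv : v = ∑ j : Fin 3, v j • EuclideanSpace.single j (1 : ℝ) := by
    simpa using ((EuclideanSpace.basisFun (Fin 3) ℝ).sum_repr v).symm
  rw [hv]
  fin_cases i
  · simp [Fin.sum_univ_three, o10, o20, mul_comm]
  · simp [Fin.sum_univ_three, o01, o21, d00, mul_comm]
  · simp [Fin.sum_univ_three, o02, o12, d00, d11, mul_comm]

/-- Parities of a bilinear map commuting with a coordinate half-turn. -/
theorem parity_two {B : E3 →L[ℝ] E3 →L[ℝ] E3} {s : Fin 3 → ℝ}
    (hs : ∀ u v, B (cubeRot 1 s u) (cubeRot 1 s v) = cubeRot 1 s (B u v)) (j k i : Fin 3) :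
    s j * s k * B (EuclideanSpace.single j (1 : ℝ)) (EuclideanSpace.single k (1 : ℝ)) i =
      s i * B (EuclideanSpace.single j (1 : ℝ)) (EuclideanSpace.single k (1 : ℝ)) i := by
  have h := congrArg (fun w : E3 => w i) (hs (EuclideanSpace.single j 1) (EuclideanSpace.single k 1))
  simp only [cubeRot_one_single, map_smul, FunLike.coe_smul, Pi.smul_apply, PiLp.smul_apply,
    smul_eq_mul, cubeRot_one_apply] at h
  linear_combination h

/-- **No quadratic O-equivariants.**  A SYMMETRIC bilinear map `ℝ³ × ℝ³ → ℝ³` commuting with the three coordinate half-turns,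
the coordinate 3-cycle and the quarter-turn about `e₂` vanishes.  (Symmetry is essential: the cross product is equivariant.) -/
theorem bilin_eq_zero (B : E3 →L[ℝ] E3 →L[ℝ] E3) (hsym : ∀ u v, B u v = B v u)
    (h0 : ∀ u v, B (cubeRot 1 ![1, -1, -1] u) (cubeRot 1 ![1, -1, -1] v) = cubeRot 1 ![1, -1, -1] (B u v))
    (h1 : ∀ u v, B (cubeRot 1 ![-1, 1, -1] u) (cubeRot 1 ![-1, 1, -1] v) = cubeRot 1 ![-1, 1, -1] (B u v))
    (hc : ∀ u v, B (cubeRot (finRotate 3) (fun _ => 1) u) (cubeRot (finRotate 3) (fun _ => 1) v) =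
      cubeRot (finRotate 3) (fun _ => 1) (B u v))
    (hq : ∀ u v, B (cubeRot (Equiv.swap 0 1) ![-1, 1, 1] u) (cubeRot (Equiv.swap 0 1) ![-1, 1, 1] v) =
      cubeRot (Equiv.swap 0 1) ![-1, 1, 1] (B u v)) :
    B = 0 := by
  -- the six components with distinct indices: 3-cycle, symmetry, quarter-turn
  have r1 : B (EuclideanSpace.single 0 (1 : ℝ)) (EuclideanSpace.single 1 (1 : ℝ)) 2 =
      B (EuclideanSpace.single 1 (1 : ℝ)) (EuclideanSpace.single 2 (1 : ℝ)) 0 := by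
    have h := congrArg (fun w : E3 => w 2) (hc (EuclideanSpace.single 1 1) (EuclideanSpace.single 2 1))
    simp only [cubeRot_cycle_single_one, cubeRot_cycle_single_two, cubeRot_cycle_apply_two] at h
    exact h
  have r2 : B (EuclideanSpace.single 1 (1 : ℝ)) (EuclideanSpace.single 2 (1 : ℝ)) 0 =
      B (EuclideanSpace.single 2 (1 : ℝ)) (EuclideanSpace.single 0 (1 : ℝ)) 1 := by
    have h := congrArg (fun w : E3 => w 0) (hc (EuclideanSpace.single 2 1) (EuclideanSpace.single 0 1))
    simp only [cubeRot_cycle_single_two, cubeRot_cycle_single_zero, cubeRot_cycle_apply_zero] at h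
    exact h
  have r3 : B (EuclideanSpace.single 1 (1 : ℝ)) (EuclideanSpace.single 0 (1 : ℝ)) 2 =
      B (EuclideanSpace.single 2 (1 : ℝ)) (EuclideanSpace.single 1 (1 : ℝ)) 0 := by
    have h := congrArg (fun w : E3 => w 2) (hc (EuclideanSpace.single 2 1) (EuclideanSpace.single 1 1))
    simp only [cubeRot_cycle_single_one, cubeRot_cycle_single_two, cubeRot_cycle_apply_two] at h
    exact h
  have r4 : B (EuclideanSpace.single 2 (1 : ℝ)) (EuclideanSpace.single 1 (1 : ℝ)) 0 =
      B (EuclideanSpace.single 0 (1 : ℝ)) (EuclideanSpace.single 2 (1 : ℝ)) 1 := by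
    have h := congrArg (fun w : E3 => w 0) (hc (EuclideanSpace.single 0 1) (EuclideanSpace.single 2 1))
    simp only [cubeRot_cycle_single_zero, cubeRot_cycle_single_two, cubeRot_cycle_apply_zero] at h
    exact h
  have rq : -B (EuclideanSpace.single 0 (1 : ℝ)) (EuclideanSpace.single 2 (1 : ℝ)) 1 =
      B (EuclideanSpace.single 1 (1 : ℝ)) (EuclideanSpace.single 2 (1 : ℝ)) 0 := by
    have h := congrArg (fun w : E3 => w 1) (hq (EuclideanSpace.single 1 1) (EuclideanSpace.single 2 1))
    simp only [cubeRot_quarterTurn_single_one, cubeRot_quarterTurn_single_two, map_neg, neg_apply,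
      PiLp.neg_apply, cubeRot_quarterTurn_apply_one] at h
    exact h
  have s1 := congrArg (fun w : E3 => w 2) (hsym (EuclideanSpace.single 0 (1 : ℝ)) (EuclideanSpace.single 1 1))
  have s2 := congrArg (fun w : E3 => w 0) (hsym (EuclideanSpace.single 1 (1 : ℝ)) (EuclideanSpace.single 2 1))
  have s3 := congrArg (fun w : E3 => w 1) (hsym (EuclideanSpace.single 2 (1 : ℝ)) (EuclideanSpace.single 0 1))
  simp only at s1 s2 s3
  -- every component vanishes: repeated indices by the half-turn parities, distinct ones by the relations above
  have v000 : B (EuclideanSpace.single 0 (1 : ℝ)) (EuclideanSpace.single 0 (1 : ℝ)) 0 = 0 := by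
    have a := parity_two h1 0 0 0; norm_num [Matrix.cons_val_two, Matrix.tail_cons, Matrix.head_cons] at a; linarith
  have v001 : B (EuclideanSpace.single 0 (1 : ℝ)) (EuclideanSpace.single 0 (1 : ℝ)) 1 = 0 := by
    have a := parity_two h0 0 0 1; norm_num [Matrix.cons_val_two, Matrix.tail_cons, Matrix.head_cons] at a; linarith
  have v002 : B (EuclideanSpace.single 0 (1 : ℝ)) (EuclideanSpace.single 0 (1 : ℝ)) 2 = 0 := by
    have a := parity_two h0 0 0 2; norm_num [Matrix.cons_val_two, Matrix.tail_cons, Matrix.head_cons] at a; linarith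
  have v010 : B (EuclideanSpace.single 0 (1 : ℝ)) (EuclideanSpace.single 1 (1 : ℝ)) 0 = 0 := by
    have a := parity_two h0 0 1 0; norm_num [Matrix.cons_val_two, Matrix.tail_cons, Matrix.head_cons] at a; linarith
  have v011 : B (EuclideanSpace.single 0 (1 : ℝ)) (EuclideanSpace.single 1 (1 : ℝ)) 1 = 0 := by
    have a := parity_two h1 0 1 1; norm_num [Matrix.cons_val_two, Matrix.tail_cons, Matrix.head_cons] at a; linarith
  have v012 : B (EuclideanSpace.single 0 (1 : ℝ)) (EuclideanSpace.single 1 (1 : ℝ)) 2 = 0 := by linarith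
  have v020 : B (EuclideanSpace.single 0 (1 : ℝ)) (EuclideanSpace.single 2 (1 : ℝ)) 0 = 0 := by
    have a := parity_two h0 0 2 0; norm_num [Matrix.cons_val_two, Matrix.tail_cons, Matrix.head_cons] at a; linarith
  have v021 : B (EuclideanSpace.single 0 (1 : ℝ)) (EuclideanSpace.single 2 (1 : ℝ)) 1 = 0 := by linarith
  have v022 : B (EuclideanSpace.single 0 (1 : ℝ)) (EuclideanSpace.single 2 (1 : ℝ)) 2 = 0 := by
    have a := parity_two h1 0 2 2; norm_num [Matrix.cons_val_two, Matrix.tail_cons, Matrix.head_cons] at a; linarith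
  have v100 : B (EuclideanSpace.single 1 (1 : ℝ)) (EuclideanSpace.single 0 (1 : ℝ)) 0 = 0 := by
    have a := parity_two h0 1 0 0; norm_num [Matrix.cons_val_two, Matrix.tail_cons, Matrix.head_cons] at a; linarith
  have v101 : B (EuclideanSpace.single 1 (1 : ℝ)) (EuclideanSpace.single 0 (1 : ℝ)) 1 = 0 := by
    have a := parity_two h1 1 0 1; norm_num [Matrix.cons_val_two, Matrix.tail_cons, Matrix.head_cons] at a; linarith
  have v102 : B (EuclideanSpace.single 1 (1 : ℝ)) (EuclideanSpace.single 0 (1 : ℝ)) 2 = 0 := by linarith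
  have v110 : B (EuclideanSpace.single 1 (1 : ℝ)) (EuclideanSpace.single 1 (1 : ℝ)) 0 = 0 := by
    have a := parity_two h1 1 1 0; norm_num [Matrix.cons_val_two, Matrix.tail_cons, Matrix.head_cons] at a; linarith
  have v111 : B (EuclideanSpace.single 1 (1 : ℝ)) (EuclideanSpace.single 1 (1 : ℝ)) 1 = 0 := by
    have a := parity_two h0 1 1 1; norm_num [Matrix.cons_val_two, Matrix.tail_cons, Matrix.head_cons] at a; linarith
  have v112 : B (EuclideanSpace.single 1 (1 : ℝ)) (EuclideanSpace.single 1 (1 : ℝ)) 2 = 0 := by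
    have a := parity_two h0 1 1 2; norm_num [Matrix.cons_val_two, Matrix.tail_cons, Matrix.head_cons] at a; linarith
  have v120 : B (EuclideanSpace.single 1 (1 : ℝ)) (EuclideanSpace.single 2 (1 : ℝ)) 0 = 0 := by linarith
  have v121 : B (EuclideanSpace.single 1 (1 : ℝ)) (EuclideanSpace.single 2 (1 : ℝ)) 1 = 0 := by
    have a := parity_two h0 1 2 1; norm_num [Matrix.cons_val_two, Matrix.tail_cons, Matrix.head_cons] at a; linarith
  have v122 : B (EuclideanSpace.single 1 (1 : ℝ)) (EuclideanSpace.single 2 (1 : ℝ)) 2 = 0 := by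
    have a := parity_two h0 1 2 2; norm_num [Matrix.cons_val_two, Matrix.tail_cons, Matrix.head_cons] at a; linarith
  have v200 : B (EuclideanSpace.single 2 (1 : ℝ)) (EuclideanSpace.single 0 (1 : ℝ)) 0 = 0 := by
    have a := parity_two h0 2 0 0; norm_num [Matrix.cons_val_two, Matrix.tail_cons, Matrix.head_cons] at a; linarith
  have v201 : B (EuclideanSpace.single 2 (1 : ℝ)) (EuclideanSpace.single 0 (1 : ℝ)) 1 = 0 := by linarith
  have v202 : B (EuclideanSpace.single 2 (1 : ℝ)) (EuclideanSpace.single 0 (1 : ℝ)) 2 = 0 := by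
    have a := parity_two h1 2 0 2; norm_num [Matrix.cons_val_two, Matrix.tail_cons, Matrix.head_cons] at a; linarith
  have v210 : B (EuclideanSpace.single 2 (1 : ℝ)) (EuclideanSpace.single 1 (1 : ℝ)) 0 = 0 := by linarith
  have v211 : B (EuclideanSpace.single 2 (1 : ℝ)) (EuclideanSpace.single 1 (1 : ℝ)) 1 = 0 := by
    have a := parity_two h0 2 1 1; norm_num [Matrix.cons_val_two, Matrix.tail_cons, Matrix.head_cons] at a; linarith
  have v212 : B (EuclideanSpace.single 2 (1 : ℝ)) (EuclideanSpace.single 1 (1 : ℝ)) 2 = 0 := by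
    have a := parity_two h0 2 1 2; norm_num [Matrix.cons_val_two, Matrix.tail_cons, Matrix.head_cons] at a; linarith
  have v220 : B (EuclideanSpace.single 2 (1 : ℝ)) (EuclideanSpace.single 2 (1 : ℝ)) 0 = 0 := by
    have a := parity_two h1 2 2 0; norm_num [Matrix.cons_val_two, Matrix.tail_cons, Matrix.head_cons] at a; linarith
  have v221 : B (EuclideanSpace.single 2 (1 : ℝ)) (EuclideanSpace.single 2 (1 : ℝ)) 1 = 0 := by
    have a := parity_two h0 2 2 1; norm_num [Matrix.cons_val_two, Matrix.tail_cons, Matrix.head_cons] at a; linarith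
  have v222 : B (EuclideanSpace.single 2 (1 : ℝ)) (EuclideanSpace.single 2 (1 : ℝ)) 2 = 0 := by
    have a := parity_two h0 2 2 2; norm_num [Matrix.cons_val_two, Matrix.tail_cons, Matrix.head_cons] at a; linarith
  have all : ∀ j k i : Fin 3, B (EuclideanSpace.single j (1 : ℝ)) (EuclideanSpace.single k (1 : ℝ)) i = 0 := by
    intro j k i
    fin_cases j <;> fin_cases k <;> fin_cases i
    exacts [v000, v001, v002, v010, v011, v012, v020, v021, v022, v100, v101, v102, v110, v111, v112, v120, v121, v122, v200, v201, v202, v210, v211, v212, v220, v221, v222]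
  ext u v i
  have hu : u = ∑ j : Fin 3, u j • EuclideanSpace.single j (1 : ℝ) := by
    simpa using ((EuclideanSpace.basisFun (Fin 3) ℝ).sum_repr u).symm
  have hv : v = ∑ j : Fin 3, v j • EuclideanSpace.single j (1 : ℝ) := by
    simpa using ((EuclideanSpace.basisFun (Fin 3) ℝ).sum_repr v).symm
  rw [hu, hv]
  simp [Fin.sum_univ_three, all]



/-! ### The curl of a Jacobian is a pseudo-vector under the generators -/

section CurlTransport

/-- The curl is a pseudo-vector — half-turn case: if `D' ∘ h = h ∘ D` for a coordinate sign change `h = diag(s)`, `sᵢ = ±1`,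
`s₀s₁s₂ = 1`, then `curlCLM D' = h (curlCLM D)`. -/
theorem curlCLM_halfTurn {s : Fin 3 → ℝ} (hs : ∀ i, s i = 1 ∨ s i = -1) (hprod : s 0 * s 1 * s 2 = 1)
    {D D' : E3 →L[ℝ] E3} (hE : ∀ v, D' (cubeRot 1 s v) = cubeRot 1 s (D v)) :
    curlCLM D' = cubeRot 1 s (curlCLM D) := by
  have hsq : ∀ i, s i * s i = 1 := fun i => by rcases hs i with h | h <;> simp [h]
  have hjk : ∀ j k, D' (EuclideanSpace.single j (1 : ℝ)) k = s j * s k * D (EuclideanSpace.single j (1 : ℝ)) k := by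
    intro j k
    have h := congrArg (fun w : E3 => w k) (hE (EuclideanSpace.single j 1))
    simp only [cubeRot_one_single, map_smul, PiLp.smul_apply, smul_eq_mul, cubeRot_one_apply] at h
    have : D' (EuclideanSpace.single j (1 : ℝ)) k = s j * (s j * D' (EuclideanSpace.single j (1 : ℝ)) k) := by
      rw [← mul_assoc, hsq, one_mul]
    rw [this, h]; ring
  have c0 : s 1 * s 2 = s 0 := by
    rcases hs 0 with h0 | h0 <;> rcases hs 1 with h1 | h1 <;> rcases hs 2 with h2 | h2 <;>
      norm_num [h0, h1, h2] at hprod <;> norm_num [h0, h1, h2]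
  have c1 : s 2 * s 0 = s 1 := by
    rcases hs 0 with h0 | h0 <;> rcases hs 1 with h1 | h1 <;> rcases hs 2 with h2 | h2 <;>
      norm_num [h0, h1, h2] at hprod <;> norm_num [h0, h1, h2]
  have c2 : s 0 * s 1 = s 2 := by
    rcases hs 0 with h0 | h0 <;> rcases hs 1 with h1 | h1 <;> rcases hs 2 with h2 | h2 <;>
      norm_num [h0, h1, h2] at hprod <;> norm_num [h0, h1, h2]
  rw [curlCLM_apply, curlCLM_apply]
  ext i
  fin_cases i <;> simp [cubeRot_one_apply, hjk]
  · rw [← c0]; ring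
  · rw [← c1]; ring
  · rw [← c2]; ring

/-- The curl is a pseudo-vector — 3-cycle case. -/
theorem curlCLM_cycle {D D' : E3 →L[ℝ] E3}
    (hE : ∀ v, D' (cubeRot (finRotate 3) (fun _ => 1) v) = cubeRot (finRotate 3) (fun _ => 1) (D v)) :
    curlCLM D' = cubeRot (finRotate 3) (fun _ => 1) (curlCLM D) := by
  have d0 : D' (EuclideanSpace.single 0 (1 : ℝ)) = cubeRot (finRotate 3) (fun _ => 1) (D (EuclideanSpace.single 1 1)) := by
    rw [← hE, cubeRot_cycle_single_one]
  have d1 : D' (EuclideanSpace.single 1 (1 : ℝ)) = cubeRot (finRotate 3) (fun _ => 1) (D (EuclideanSpace.single 2 1)) := by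
    rw [← hE, cubeRot_cycle_single_two]
  have d2 : D' (EuclideanSpace.single 2 (1 : ℝ)) = cubeRot (finRotate 3) (fun _ => 1) (D (EuclideanSpace.single 0 1)) := by
    rw [← hE, cubeRot_cycle_single_zero]
  rw [curlCLM_apply, curlCLM_apply, d0, d1, d2]
  simp only [cubeRot_cycle_apply]
  ext i
  fin_cases i <;> simp

/-- The curl is a pseudo-vector — quarter-turn case. -/
theorem curlCLM_quarterTurn {D D' : E3 →L[ℝ] E3}
    (hE : ∀ v, D' (cubeRot (Equiv.swap 0 1) ![-1, 1, 1] v) = cubeRot (Equiv.swap 0 1) ![-1, 1, 1] (D v)) :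
    curlCLM D' = cubeRot (Equiv.swap 0 1) ![-1, 1, 1] (curlCLM D) := by
  have q0 : cubeRot (Equiv.swap 0 1) ![-1, 1, 1] (EuclideanSpace.single 0 (1 : ℝ)) = EuclideanSpace.single 1 (1 : ℝ) := by
    rw [cubeRot_quarterTurn_apply]; ext i; fin_cases i <;> simp
  have d1 : D' (EuclideanSpace.single 1 (1 : ℝ)) = cubeRot (Equiv.swap 0 1) ![-1, 1, 1] (D (EuclideanSpace.single 0 1)) := by
    rw [← hE, q0]
  have d0 : D' (EuclideanSpace.single 0 (1 : ℝ)) = -cubeRot (Equiv.swap 0 1) ![-1, 1, 1] (D (EuclideanSpace.single 1 1)) := by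
    rw [← hE, cubeRot_quarterTurn_single_one, map_neg, neg_neg]
  have d2 : D' (EuclideanSpace.single 2 (1 : ℝ)) = cubeRot (Equiv.swap 0 1) ![-1, 1, 1] (D (EuclideanSpace.single 2 1)) := by
    rw [← hE, cubeRot_quarterTurn_single_two]
  rw [curlCLM_apply, curlCLM_apply, d0, d1, d2]
  simp only [cubeRot_quarterTurn_apply]
  ext i
  fin_cases i <;> simp <;> ring

end CurlTransport

end CentreFlat

end Summit.NavierStokesRegularity.NavierStokesRegularity.Theorems.PoloidalLiouville.Platonic

end
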